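import Summits.QuantumFields.YangMills.Theorems.BalabanUVNodesN12AtRecord13Prop1KnitThm1OfRecord
import Summits.QuantumFields.YangMills.Theorems.BalabanUVNodesN12Prop1DirectOfChartHalf

/-!
# BalabanUVNodes ∕ N12 — «12Q-DIRECT v2»: N12's Proposition-1 row at the record ON THE DIRECT ROAD, keyed on the ASSEMBLED endpoint (P2c) `N12Prop1DirectOfChartHalf`
# ((χ)_W and `hsm` inside; window gauge letter, plaquette letter, (P4)′ socket letter, (P5) displayed) — THRESHOLD frame per run

Cell `pub-ymgap` (HUMAN RULINGS D-0062 ∕ D-0149), seat `pub-ymgap-dag-n12-d` g19 (R134 N12 [B15] s2; pen (P3) of plan g87 YMPLAN-G87-N12-ROAD on the pen-(P2c) endpoint of the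
same seat); count-neutral helper of K1⁹ `stmt-QuantumFields-27364` (`--kind proof --supports … --as helper`).  THEOREMS ONLY (0 `def`, 0 `instance`, 0 `sorry`); composition BY NAME.

WHAT.  «12Q-DIRECT» (p658022) displayed the (WD) window∕direct letter package whole.  This edition keys on (P2c) `(iii)_direct`
`N12Prop1DirectOfChartHalf.…_ofMinimiserFamily_ofWindowGaugeLetter_ofChartHalf_ofCoercive` (p662019), where the direct chart letter (χ)_W is DISCHARGED by dag-n12-w4 ∕ the
lane's repaired chart half and the numerics `hsm` by `B15Prop1NumericsThresholds` §6, in the THRESHOLD frame: per run `P` the endpoint produces tolerances `δ₀ P i > 0`; for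
every tolerance family `δ ≤ δ₀` and the two tolerance letters — the window gauge letter (σ)_W `hσW` and the plaquette letter `hPχ` at `δ P i` — it produces the thresholds
`areg P i` of Prop. 1.  Hence the statement: all tolerance-free rows per run ∕ instance as binders ((J0′)@eR + `h𝓐₀`, region boxes + `ρn hρn`, `Kb`, `γ₈ cJ bx`, dag-n12-w4's
geometry letter `hΩw`, the window `W` + `hWbox`, the (P4)′ and (P5) constants `B M₂`, the small-below letter `hsb`, the (P4)′ socket letter `hH` (`hsurj` + uniform bound,
dag-n12-w6 g6), the chart-curvature letter `hM₂`, `hγle` at `γ₀ = 1∕2`, geometry, `cE cA` rows, `h15`), then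
`∃ δ₀, … ∀ δ ≤ δ₀, ∀ (hσW) (hPχ), ∃ areg > 0, ∀ P, kSel < K → B15Leaf (…)`.  Generated by the seat's threshold-frame re-keyer (`lean/g19/mk_knit_thr.py`).

HONEST FRAMING ∕ LOCATED.  Bookkeeping by name over landed modules; (σ)_W (producer: the lane's `hσW_of_gaugeLetterN_on` ∘ (σ)_N, next layer), the plaquette letter, (P4)′,
(P5), (J0′), [15] Thm 1, the geometry, K0b's residuals and N12's per-run rows below the torus stay LETTERS; per-instance constants; NO topological hypothesis on `Ω₁(Z)`;
nothing of Bałaban's asserted; N12 NOT discharged; K0⁷ ∕ K1⁹ NOT closed; counts unmoved; one finite 𝕋⁴ programme at fixed `ε = L^{-K}` — R4 closes only the conditional rung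
`BalabanLadder.UV`; no summit statement is proved here and NOT the Yang–Mills mass gap (Clay); nothing continuum ∕ ℝ⁴ ∕ OS.

References: [Balaban1989LargeFieldI] CMP 122 (1989) 175–202; [Balaban1989LargeFieldII] CMP 122 (1989) 355–392; [Balaban1988Convergent] CMP 119 (1988) 243–285;
[Balaban1985Variational] CMP 102 (1985) 277–309 (locators in the theorem docstring).
-/

noncomputable section
open MeasureTheory Set Finset Metric Filter
open scoped Matrix.Norms.L2Operator BigOperators Matrix RealInnerProductSpace Real InnerProductSpace Topology

namespace Summit.QuantumFields.YangMills.BalabanUVNodes.N12AtRecord13Prop1KnitThm1WindowDirectOfChartHalfOfRecord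

open Literature.MathematicalPhysics.QuantumFieldTheory.Balaban1983to89
open Literature.MathematicalPhysics.QuantumFieldTheory.Balaban1983to89.T4Continuum (T4Family LStep Letter walk walkEnd netDisp holAt)
open Literature.MathematicalPhysics.QuantumFieldTheory.Balaban1983to89.DagBinding
open Literature.MathematicalPhysics.QuantumFieldTheory.Balaban1983to89.Node00
open FlowStep (prefixOf BetaLowerH BetaUpperH)
open B15Claim189Assembly (Setting189 new189 chiPP dom half)
open B15 (Prop1Printed Ineq180)
open B15.BasicStep (Claim189)
open B15.PrelimIntegrations (Ineq191 Ineq195)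
open B15Chi124DetSets (E124)
open B14DomainGeom (Pt)
open B8Eq17ClassAkV1 (plaqsOf)
open B14.Eq216Concrete (inputs feeds)
open GaugeGroup (dist1)
open GaugeField (plaqHol gaugeAct)
open B15Claim189PrintedConditions (omegaOfChain)
open B15Claim189PinsOfHistory (N0OfRecord₁₃)
open B15Claim189LambdaPin (enlD)
open B15RPrime1100OfRep (rPrimeDataOfSel)
open Summit.QuantumFields.YangMills.BalabanUVNodes.N12AtRecord13OfResiduals (b15Leaf_WOfRecord₁₃_liveRepin₁₃_of_massLive_of_hasResiduals)
open Summit.QuantumFields.YangMills.BalabanUVNodes.N12AtRecord13Prop1KnitThm1OfRecord (thm1TorusClass_of_variationalThm1RegSepCoP7M)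
open T4CubeChartGnomonic (SU2)
open B15Prop1ChartSU2 (su2Chart)
open B15Prop1SliceCoordinates (GaugeSlice ιA)
open T4AxialGaugeSmallField (castSite boxPlaqs boxBonds)
open B6BondElimination (unitVec)
open B6TreeGaugePoincare (curl)
open B16Eq18Proof (box)
open B15Extension193 (extend)
open B15ShellGauge193 (shellGauge)
open B15Sect1Instances (fun177std)
open B14.Eq213DetSet (Bj maxDomT)
open B14.Eq213MaximalDomains (side)
open B14.Eq22Determines (blockIter IsBlockUnion)
open Literature.MathematicalPhysics.QuantumFieldTheory.BalabanImbrieJaffe1984to88.BIJ85Eq453GaugeField (qsstarGIter0)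
open B16Sect1Backgrounds (expMul toMS)
open B15DeterminingSets (pts DetBackground genSet IsMinimizer MSField avgFamily bondsOf DetSet embIter)
open B5Eq118OneStroke (iterBlockOf)
open ExpMeanLog (deltaSU)
open B15Prop1Carrier (lfVarOn InstOn InstOn.std plaqsInside)
open Summit.QuantumFields.YangMills.BalabanUVNodes.N12Prop1DirectOfChartHalf (exists_domain_prop1Printed_lfVarOn_std_su2_box_intrinsic_analytic_atZSeqCoPRecord_ofThm1TorusClass_ofMinimiserFamily_ofWindowGaugeLetter_ofChartHalf_ofCoercive)
open T4AdjointCovarianceUnitary (lieSU)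
open B15Prop1GradientFromNearValueAtCoPRecord (far_letter_of_box)
open B15Prop1AnalyticExtClause (cplxVec anExt)
open B15Prop1ChartCalculusSU2 (E3)

variable {F : T4Family}

/-! ## §1 `N = 2`, generic `Θ` carrying node00-def-K0b's residuals: N12's Prop-1 row keyed on the ASSEMBLED DIRECT endpoint (P2c), threshold frame -/

section Generic
variable (Θ : Stage13Params F 2) (lam : ResidW F 2)

/-- **★★★★ N12's ROW BELOW THE TORUS AT THE LIVE RE-PIN, `N = 2`, AT PRINT's (1.74) OBJECT, PROP. 1 ON THE DIRECT ROAD FROM THE ASSEMBLED ENDPOINT (P2c),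
THRESHOLD FRAME** — per run `P` the endpoint `N12Prop1DirectOfChartHalf.…_ofWindowGaugeLetter_ofChartHalf_ofCoercive` (tolerance-free letters fed per run ∕ instance)
yields `δ₀ P`; for `δ ≤ δ₀` and the per-run tolerance letters `hσW` ((σ)_W at `δ`) and `hPχ` (plaquette letter at `δ`) it yields `areg P`; then 12E's
`b15Leaf_WOfRecord₁₃_liveRepin₁₃_of_massLive_of_hasResiduals`.  Displayed: see the module docstring.  Count-neutral; NOT a discharge of N12. [cite: Balaban1989LargeFieldI, (0.2)–(0.6) p.176, (1.74) p.192, p.193 ll.14–20, Prop. 1 (1.77)–(1.78) p.194 («for ε > 0 sufficiently small»), (1.79)–(1.80) p.195, (1.89) p.198, (1.99)–(1.102) pp.200–201; Balaban1989LargeFieldII, p.357, (1.7)–(1.13) pp.358–359, (1.17)–(1.19) pp.360–361; Balaban1988Convergent, (2.1) p.254, (2.12)–(2.14) pp.256–257, (2.18) p.257, (3.16) p.268, (3.22)–(3.25) pp.269–270; Balaban1985Variational, (3)–(4) p.278, Thm 1 (8) p.279, (16)–(18) p.280, Prop. 9 (190) p.309 (bookkeeping)] -/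
theorem exists_areg_pinLF_b15Leaf_WOfRecord₁₃_liveRepin₁₃_of_massLive_of_hasResiduals_of_variationalThm1RegSepCoP7M_atZSeqCoPRecord_windowDirectOfChartHalf (hres : Θ.HasResidualsOfRecord F 2)
    -- N12's displays at the letters `kSel ∕ D189 ∕ D1100` of `λ`, run by run, BELOW THE TORUS
    (hpin : ∀ P : B12.RunParams, lam.kSel P < P.K → lam.D1100 P
      = rPrimeDataOfSel (reprTOfRecord₁₃ F 2 (Θ.liveRepin₁₃ F 2) P (lam.kSel P))
          ((Θ.liveRepin₁₃ F 2).ppSel P (gOfRecord₁₃ F 2 (Θ.liveRepin₁₃ F 2) P) (lam.kSel P + 1))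
          (fibOfSeq F (Θ.liveRepin₁₃ F 2).ν (Θ.liveRepin₁₃ F 2).τ9 P (gOfRecord₁₃ F 2 (Θ.liveRepin₁₃ F 2) P) (lam.kSel P + 1)))
    (hmassLive : ∀ P : B12.RunParams, lam.kSel P < P.K → ∀ s, LiveSeq F 2 Θ.ν Θ.τ9 P (gOfRecord₁₃ F 2 (Θ.liveRepin₁₃ F 2) P) (lam.kSel P + 1)
        (slotsTOfRecord F 2 Θ.ν Θ.τ9 (EOfRecord₁₃ F 2 (Θ.liveRepin₁₃ F 2)) (wOfRecord₉ F 2 (Θ.liveRepin₁₃ F 2).toStage9Params)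
          (Θ.liveRepin₁₃ F 2).ppSel P (gOfRecord₁₃ F 2 (Θ.liveRepin₁₃ F 2) P) (lam.kSel P + 1)) s →
      0 < ∫ V, rterm (reprTOfRecord₁₃ F 2 (Θ.liveRepin₁₃ F 2) P (lam.kSel P)) s V ∂(fieldMeasure (F.P P.K) (lam.kSel P + 1) (SU 2)))
    (h180 : ∀ P : B12.RunParams, lam.kSel P < P.K → ∀ U, new189 (lam.D189 P) U → ∀ i, (lam.D189 P).h ≤ i → i ≤ (lam.D189 P).k →
      ∀ q ∈ plaqsOf (dom (lam.D189 P) i),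
        Ineq180 ((lam.D189 P).dev0 U q) ((lam.D189 P).ε (lam.D189 P).k) (lam.D189 P).η (lam.D189 P).B₃ (lam.D189 P).B₅ (lam.D189 P).M (lam.D189 P).δ
          ((lam.D189 P).dist q) (lam.D189 P).O1)
    (h189 : ∀ P : B12.RunParams, lam.kSel P < P.K → Claim189 (new189 (lam.D189 P)) (chiPP (lam.D189 P)))
    -- dag-n12-w5's endpoint `N12Prop1DirectOfChartHalf` ON THE RUN's LATTICE, per run `P` and instance family `ι P` (every letter of the endpoint displayed per run;
    -- `hfar` from the knit's box letter `hZ1` by `far_letter_of_box`, the [15] torus-class letter from `h15` by `thm1TorusClass_of_variationalThm1RegSepCoP7M`)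
    (hd3 : ∀ P : B12.RunParams, 3 ≤ (F.P P.K).d) (h0 : ∀ P : B12.RunParams, 0 < (F.P P.K).d) (ι : B12.RunParams → Type)
    {B₃ a₀ a₁' : ℝ}
    (Z Λ : ∀ P : B12.RunParams, ι P → Set (Site (F.P P.K) 0)) (k : ∀ P : B12.RunParams, ι P → ℕ) (M : ∀ P : B12.RunParams, ι P → ℝ) (hk0 : ∀ (P : B12.RunParams) (i : ι P), 0 < k P i) (hk : ∀ (P : B12.RunParams) (i : ι P), k P i ≤ (F.P P.K).m + (F.P P.K).K)
    (eR : ∀ P : B12.RunParams, ι P → ℝ) (heR : ∀ (P : B12.RunParams) (i : ι P), 0 < eR P i)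
    (T : ∀ (P : B12.RunParams) (i : ι P), Finset (PBond (F.P P.K) (k P i)))
    (lo hi : ∀ P : B12.RunParams, ι P → Fin (F.P P.K).d → ℤ) (n : ∀ P : B12.RunParams, ι P → ℕ) (hn : ∀ (P : B12.RunParams) (i : ι P) κ, hi P i κ ≤ lo P i κ + n P i) (hN : ∀ (P : B12.RunParams) (i : ι P), n P i + 2 < (F.P P.K).sitesPerDir (k P i))
    (hbox : ∀ (P : B12.RunParams) (i : ι P), pts (k P i) (Λ P i) = (castSite '' Set.Icc (lo P i) (hi P i) : Set (Site (F.P P.K) (k P i))))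
    (hZ : ∀ (P : B12.RunParams) (i : ι P), (boxPlaqs (lo P i - 1) (hi P i + 1) : Set (Plaq (F.P P.K) (k P i))) ⊆ plaqsInside (pts (k P i) (Z P i)))
    (hTG0 : ∀ (P : B12.RunParams) (i : ι P), T P i = (box (fun κ => (hi P i κ - lo P i κ + 1).toNat) (lo P i)).image fun x =>
      (⟨castSite (x - unitVec ⟨0, h0 P⟩), ⟨0, h0 P⟩⟩ : PBond (F.P P.K) (k P i)))
    (hN5 : ∀ (P : B12.RunParams) (i : ι P) κ, ((hi P i κ - lo P i κ + 1).toNat : ℤ) + 5 < (F.P P.K).sitesPerDir (k P i))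
    (Kb : ∀ P : B12.RunParams, ι P → ℕ) (hK1 : ∀ (P : B12.RunParams) (i : ι P), 1 ≤ Kb P i) (hKn : ∀ (P : B12.RunParams) (i : ι P) κ, (hi P i κ - lo P i κ + 1).toNat ≤ Kb P i)
    (ext : ∀ (P : B12.RunParams) (i : ι P), GaugeField (F.P P.K) (k P i) SU2 → GaugeField (F.P P.K) (k P i) SU2)
    (hext : ∀ (P : B12.RunParams) (i : ι P) Vk, ext P i Vk = extend (pts (k P i) (Λ P i)) (shellGauge Vk (lo P i) (hi P i)) Vk)
    (hlohi : ∀ (P : B12.RunParams) (i : ι P), lo P i ≤ hi P i)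
    -- the REGION parallelepipeds of the normalisation and the datum tolerances
    (LO HI : ∀ P : B12.RunParams, ι P → Fin (F.P P.K).d → ℤ) (hLO : ∀ (P : B12.RunParams) (i : ι P), LO P i ≤ lo P i - 1) (hHI : ∀ (P : B12.RunParams) (i : ι P), hi P i + 1 ≤ HI P i) (n' : ∀ P : B12.RunParams, ι P → ℕ) (hn' : ∀ (P : B12.RunParams) (i : ι P) κ, HI P i κ ≤ LO P i κ + n' P i)
    (hn'N : ∀ (P : B12.RunParams) (i : ι P), n' P i < (F.P P.K).sitesPerDir (k P i)) (hR' : ∀ (P : B12.RunParams) (i : ι P), (boxPlaqs (LO P i) (HI P i) : Set (Plaq (F.P P.K) (k P i))) ⊆ plaqsInside (pts (k P i) (Z P i)))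
    (ρn : ∀ P : B12.RunParams, ι P → ℝ)
    (hρn : ∀ (P : B12.RunParams) (i : ι P), (((F.P P.K).d : ℝ) * n' P i + 1) * ((((F.P P.K).d - 1 : ℕ) : ℝ) * n' P i * ((12 * (F.P P.K).d * (n P i + 2) ^ 2 + 1) * eR P i)
      + 3 * (F.P P.K).d * (n P i + 2) ^ 2 * eR P i) ≤ ρn P i)
    {γ₈ cJ bx : B12.RunParams → ℝ} (hγ : ∀ P : B12.RunParams, 0 < γ₈ P) (hcJ : ∀ P : B12.RunParams, 0 ≤ cJ P) (hbx : ∀ P : B12.RunParams, 0 ≤ bx P)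
    (hbxM : ∀ (P : B12.RunParams) (i : ι P), 12 * ((F.P P.K).d : ℝ) * ((n P i : ℝ) + 2) ^ 2 ≤ bx P * (M P i) ^ 2)
    {R 𝓐₀ : ∀ P : B12.RunParams, ι P → ℝ} (hM : ∀ (P : B12.RunParams) (i : ι P), 1 ≤ (M P i)) (hR : ∀ (P : B12.RunParams) (i : ι P), 0 < R P i) (h𝓐₀ : ∀ (P : B12.RunParams) (i : ι P), 0 ≤ 𝓐₀ P i)
    -- (J0′), R-EXPLICIT: per instance one radius and one bound for every base field of the strict guard
    (hMin : ∀ (P : B12.RunParams) (i : ι P) Vk, PlaqSmallOn (plaqsInside (pts (k P i) (Z P i ∩ (Λ P i)ᶜ))) (eR P i) Vk →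
      ∃ Ũ : VecField (F.P P.K) (k P i) (EuclideanSpace ℂ (Fin 3)) × VecField (F.P P.K) (k P i) (EuclideanSpace ℂ (Fin 3)) →
          PBond (F.P P.K) 0 → Matrix (Fin 2) (Fin 2) ℂ,
        (∀ b a c, DifferentiableOn ℂ (fun z => Ũ z b a c) (ball 0 (R P i))) ∧
        (∀ z ∈ ball (0 : VecField (F.P P.K) (k P i) (EuclideanSpace ℂ (Fin 3)) × VecField (F.P P.K) (k P i) (EuclideanSpace ℂ (Fin 3))) (R P i),
          ∀ b a c, ‖Ũ z b a c‖ ≤ 𝓐₀ P i) ∧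
        ∀ p B' : VecField (F.P P.K) (k P i) E3, ‖p‖ < R P i → ‖B'‖ < R P i → ∃ U' : GaugeField (F.P P.K) 0 SU2,
          (∀ b, Ũ (cplxVec p, cplxVec B') b = ((U' b : SU2) : Matrix (Fin 2) (Fin 2) ℂ)) ∧
            IsMinimizer (Node00.avOfRecord F 2 P.K) (Node00.regMSCoPOfRecord F 2 Θ.ν P.K (k P i) (maxDomT Θ.ν.M₁ (Z P i))) (Bj Θ.ν.M₁ (Z P i) (k P i))
              (avgFamily (Node00.avOfRecord F 2 P.K) (qsstarGIter0 (k P i) (expMul su2Chart B' (ext P i (expMul su2Chart p Vk))))) U')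
    -- dag-n12-w4's GEOMETRY letter of the chart file (the window box and its two shifts inside `Ω_k(Z)`)
    (hΩw : ∀ (P : B12.RunParams) (i : ι P), ∀ (ν' : Fin (F.P P.K).d), ∀ z ∈ box (fun κ => (hi P i κ - lo P i κ + 1).toNat + 3) (fun κ => lo P i κ - 2),
      (castSite z : Site (F.P P.K) (k P i)) ∈ pts (k P i) (maxDomT Θ.ν.M₁ (Z P i) (k P i)) ∧
        (castSite z : Site (F.P P.K) (k P i)).shift ⟨0, h0 P⟩ ∈ pts (k P i) (maxDomT Θ.ν.M₁ (Z P i) (k P i)) ∧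
        (castSite z : Site (F.P P.K) (k P i)).shift ν' ∈ pts (k P i) (maxDomT Θ.ν.M₁ (Z P i) (k P i)))
    -- the WINDOW per instance, containing every plaquette whose source lies in the fine image of the enlarged window box (the chart half's `hW`)
    (W : ∀ P : B12.RunParams, ι P → Finset (Plaq (F.P P.K) 0))
    (hWbox : ∀ (P : B12.RunParams) (i : ι P), ∀ q : Plaq (F.P P.K) 0, q.src ∈ ((box (fun κ => (F.P P.K).L ^ (k P i) * ((hi P i κ - lo P i κ + 1).toNat + 3 + 1) - 1) (fun κ => ((F.P P.K).L : ℤ) ^ (k P i) * (lo P i κ - 2))).image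
        (fun z => (castSite z : Site (F.P P.K) 0))) → q ∈ W P i)
    -- the (P4)′ constant and the chart-curvature constant (P5), per instance, chosen BEFORE the base field
    (B M₂ : ∀ P : B12.RunParams, ι P → ℝ) (hB0 : ∀ (P : B12.RunParams) (i : ι P), 0 ≤ B P i) (hM₂0 : ∀ (P : B12.RunParams) (i : ι P), 0 ≤ M₂ P i)
    -- DISPLAYED per guarded base field ∕ minimiser: the small-below letter, the (P4)′ socket (`hsurj` + uniform bound, LOCATED-P4-LETTER), the chart-curvature letter (P5)
    (hsb : ∀ (P : B12.RunParams) (i : ι P) (Vk : GaugeField (F.P P.K) (k P i) SU2), PlaqSmallOn (plaqsInside (pts (k P i) (Z P i ∩ (Λ P i)ᶜ))) (eR P i) Vk →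
      (∀ b ∈ (boxBonds (LO P i) (HI P i) : Set (PBond (F.P P.K) (k P i))), dist1 (ext P i Vk b) ≤ ρn P i) →
      ∀ U₀ : GaugeField (F.P P.K) 0 SU2,
        IsMinimizer (Node00.avOfRecord F 2 P.K) (Node00.regMSCoPOfRecord F 2 Θ.ν P.K (k P i) (maxDomT Θ.ν.M₁ (Z P i))) (Bj Θ.ν.M₁ (Z P i) (k P i))
          (avgFamily (Node00.avOfRecord F 2 P.K) (qsstarGIter0 (k P i) (ext P i Vk))) U₀ →
        Node00.SmallBelow (Node00.avOfRecord F 2 P.K) (k P i) U₀)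
    (hH : ∀ (P : B12.RunParams) (i : ι P) (Vk : GaugeField (F.P P.K) (k P i) SU2), PlaqSmallOn (plaqsInside (pts (k P i) (Z P i ∩ (Λ P i)ᶜ))) (eR P i) Vk →
      (∀ b ∈ (boxBonds (LO P i) (HI P i) : Set (PBond (F.P P.K) (k P i))), dist1 (ext P i Vk b) ≤ ρn P i) →
      ∀ U₀ : GaugeField (F.P P.K) 0 SU2,
        IsMinimizer (Node00.avOfRecord F 2 P.K) (Node00.regMSCoPOfRecord F 2 Θ.ν P.K (k P i) (maxDomT Θ.ν.M₁ (Z P i))) (Bj Θ.ν.M₁ (Z P i) (k P i))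
          (avgFamily (Node00.avOfRecord F 2 P.K) (qsstarGIter0 (k P i) (ext P i Vk))) U₀ →
        ∃ H : (Fin (constrCard (Bj Θ.ν.M₁ (Z P i) (k P i)) (k P i)) → lieSU (Fin 2)) → PBond (F.P P.K) 0 → lieSU (Fin 2),
          (∀ v, fderiv ℝ (msChart F 2 P.K (k P i) (Bj Θ.ν.M₁ (Z P i) (k P i)) (avgFamily (Node00.avOfRecord F 2 P.K) (qsstarGIter0 (k P i) (ext P i Vk))) U₀) 0 (H v) = v) ∧
          (∀ v, Real.sqrt (∑ b, ‖H v b‖ ^ 2) ≤ B P i * ‖v‖))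
    (hM₂ : ∀ (P : B12.RunParams) (i : ι P) (Vk : GaugeField (F.P P.K) (k P i) SU2), PlaqSmallOn (plaqsInside (pts (k P i) (Z P i ∩ (Λ P i)ᶜ))) (eR P i) Vk →
      (∀ b ∈ (boxBonds (LO P i) (HI P i) : Set (PBond (F.P P.K) (k P i))), dist1 (ext P i Vk b) ≤ ρn P i) →
      ∀ U₀ : GaugeField (F.P P.K) 0 SU2,
        IsMinimizer (Node00.avOfRecord F 2 P.K) (Node00.regMSCoPOfRecord F 2 Θ.ν P.K (k P i) (maxDomT Θ.ν.M₁ (Z P i))) (Bj Θ.ν.M₁ (Z P i) (k P i))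
          (avgFamily (Node00.avOfRecord F 2 P.K) (qsstarGIter0 (k P i) (ext P i Vk))) U₀ →
        ∀ w, ‖fderiv ℝ (fderiv ℝ (msChart F 2 P.K (k P i) (Bj Θ.ν.M₁ (Z P i) (k P i)) (avgFamily (Node00.avOfRecord F 2 P.K) (qsstarGIter0 (k P i) (ext P i Vk))) U₀)) 0 w w‖ ≤ M₂ P i * ‖w‖ ^ 2)
    -- numerics: the positivity constant fits (`γ₀ := 1∕2`: the chart half's level factor `((L^d)^k∕(L²·L²)^k)∕2` at `d = 4`)
    (hγle : ∀ (P : B12.RunParams) (i : ι P), γ₈ P / (M P i) ^ 5 ≤ 1 / 2 / (2 * (3 * (Kb P i : ℝ) ^ 2 + 2 * (Kb P i : ℝ) ^ 4)))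
    -- the geometric letter: every fine site whose k-block label lies in the box `[lo − 1, hi + 1]` lies in `Ω₁(Z)` (print: `Λ` deep inside `Z`); dag-n12-c's `far_letter_of_box` turns it into the bond letter `hfar`
    (hZ1 : ∀ (P : B12.RunParams) (i : ι P) (y : Site (F.P P.K) 0), B14.Eq22Determines.blockIter (k P i) y ∈ (castSite '' Set.Icc (lo P i - 1) (hi P i + 1) : Set (Site (F.P P.K) (k P i))) → y ∈ maxDomT Θ.ν.M₁ (Z P i) 1)
    (hZblk : ∀ (P : B12.RunParams) (i : ι P), IsBlockUnion (k P i) (Z P i))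
    (hdiv : ∀ (P : B12.RunParams) (i : ι P), side (F.P P.K).L Θ.ν.M₁ (k P i) ∣ (F.P P.K).sitesPerDir 0)
    {cE cA : B12.RunParams → ℝ} (hcE0 : ∀ P : B12.RunParams, 0 ≤ cE P) (hcE : ∀ (P : B12.RunParams) (i : ι P), 12 * ((F.P P.K).d : ℝ) * ((n P i : ℝ) + 2) ^ 2 ≤ cE P)
    (heRa : ∀ (P : B12.RunParams) (i : ι P), (cE P + 1) * eR P i ≤ a₁' ∧ B₃ * ((cE P + 1) * eR P i) ≤ Θ.ν.εreg)
    (hcA : ∀ P : B12.RunParams, 1 / 2 * (B₃ * (cE P + 1) * (F.P P.K).eta 1 ^ 2) ^ 2 * (Fintype.card (Plaq (F.P P.K) 0) : ℝ) ≤ cA P)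
    (hcJ' : ∀ (P : B12.RunParams) (i : ι P), 2 * cA P * eR P i / R P i + 4 * ((Fintype.card (Plaq (F.P P.K) 0) : ℝ) * (1 + 8 * 𝓐₀ P i ^ 4)) / (R P i * eR P i) ≤ cJ P)
    (hM2 : 2 ≤ Θ.ν.M₁) (hB₃ : 0 ≤ B₃) (ha₀ : Θ.ν.εreg ≤ a₀) (h15 : VariationalThm1RegSepCoP7M F 2 B₃ a₀ a₁') :
    ∃ δ₀ : ∀ P : B12.RunParams, ι P → ℝ, (∀ P i, 0 < δ₀ P i) ∧ ∀ δ : ∀ P : B12.RunParams, ι P → ℝ, (∀ P i, 0 < δ P i) → (∀ P i, δ P i ≤ δ₀ P i) →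
      -- the two TOLERANCE letters of the endpoint, per run, at the thresholded tolerance `δ P i`
      ∀ (hσW : ∀ (P : B12.RunParams) (i : ι P) (Vk : GaugeField (F.P P.K) (k P i) SU2), PlaqSmallOn (plaqsInside (pts (k P i) (Z P i ∩ (Λ P i)ᶜ))) (eR P i) Vk →
      (∀ b ∈ (boxBonds (LO P i) (HI P i) : Set (PBond (F.P P.K) (k P i))), dist1 (ext P i Vk b) ≤ ρn P i) →
      ∀ U₀ : GaugeField (F.P P.K) 0 SU2,
        IsMinimizer (Node00.avOfRecord F 2 P.K) (Node00.regMSCoPOfRecord F 2 Θ.ν P.K (k P i) (maxDomT Θ.ν.M₁ (Z P i))) (Bj Θ.ν.M₁ (Z P i) (k P i))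
          (avgFamily (Node00.avOfRecord F 2 P.K) (qsstarGIter0 (k P i) (ext P i Vk))) U₀ →
        ∃ σ : GaugeTransf (F.P P.K) 0 SU2,
          (∀ j, j ≤ k P i → ∀ b ∈ bondsOf (Bj Θ.ν.M₁ (Z P i) (k P i) j), toMS σ j b.src = 1 ∧ toMS σ j b.tgt = 1) ∧
          (∀ p ∈ W P i, ‖((gaugeAct σ U₀ ⟨p.src, p.μ⟩ : SU2) : Matrix (Fin 2) (Fin 2) ℂ) - 1‖ ≤ δ P i ∧ ‖((gaugeAct σ U₀ ⟨p.src.shift p.μ, p.ν⟩ : SU2) : Matrix (Fin 2) (Fin 2) ℂ) - 1‖ ≤ δ P i ∧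
            ‖((gaugeAct σ U₀ ⟨p.src.shift p.ν, p.μ⟩ : SU2) : Matrix (Fin 2) (Fin 2) ℂ) - 1‖ ≤ δ P i ∧ ‖((gaugeAct σ U₀ ⟨p.src, p.ν⟩ : SU2) : Matrix (Fin 2) (Fin 2) ℂ) - 1‖ ≤ δ P i) ∧
          (∀ (ν' : Fin (F.P P.K).d), ∀ z ∈ box (fun κ => (hi P i κ - lo P i κ + 1).toNat + 3) (fun κ => lo P i κ - 2), ∀ b₀ : PBond (F.P P.K) 0,
            (b₀ ∈ feeds (k P i) (⟨(castSite z : Site (F.P P.K) (k P i)), ⟨0, h0 P⟩⟩ : PBond (F.P P.K) (k P i)) ∨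
              b₀ ∈ feeds (k P i) (⟨((castSite z : Site (F.P P.K) (k P i))).shift ⟨0, h0 P⟩, ν'⟩ : PBond (F.P P.K) (k P i)) ∨
              b₀ ∈ feeds (k P i) (⟨((castSite z : Site (F.P P.K) (k P i))).shift ν', ⟨0, h0 P⟩⟩ : PBond (F.P P.K) (k P i)) ∨
              b₀ ∈ feeds (k P i) (⟨(castSite z : Site (F.P P.K) (k P i)), ν'⟩ : PBond (F.P P.K) (k P i))) →
            ‖((gaugeAct σ U₀ b₀ : SU2) : Matrix (Fin 2) (Fin 2) ℂ) - 1‖ ≤ δ P i))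
      (hPχ : ∀ (P : B12.RunParams) (i : ι P) (Vk : GaugeField (F.P P.K) (k P i) SU2), PlaqSmallOn (plaqsInside (pts (k P i) (Z P i ∩ (Λ P i)ᶜ))) (eR P i) Vk →
      (∀ b ∈ (boxBonds (LO P i) (HI P i) : Set (PBond (F.P P.K) (k P i))), dist1 (ext P i Vk b) ≤ ρn P i) →
      ∀ U₀ : GaugeField (F.P P.K) 0 SU2,
        IsMinimizer (Node00.avOfRecord F 2 P.K) (Node00.regMSCoPOfRecord F 2 Θ.ν P.K (k P i) (maxDomT Θ.ν.M₁ (Z P i))) (Bj Θ.ν.M₁ (Z P i) (k P i))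
          (avgFamily (Node00.avOfRecord F 2 P.K) (qsstarGIter0 (k P i) (ext P i Vk))) U₀ →
        ∀ p : Plaq (F.P P.K) 0, ((⟨p.src, p.μ⟩ : PBond (F.P P.K) 0) ∈ {b : PBond (F.P P.K) 0 | b.src ∈ maxDomT Θ.ν.M₁ (Z P i) 1} ∨
            (⟨p.src.shift p.μ, p.ν⟩ : PBond (F.P P.K) 0) ∈ {b : PBond (F.P P.K) 0 | b.src ∈ maxDomT Θ.ν.M₁ (Z P i) 1} ∨
            (⟨p.src.shift p.ν, p.μ⟩ : PBond (F.P P.K) 0) ∈ {b : PBond (F.P P.K) 0 | b.src ∈ maxDomT Θ.ν.M₁ (Z P i) 1} ∨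
            (⟨p.src, p.ν⟩ : PBond (F.P P.K) 0) ∈ {b : PBond (F.P P.K) 0 | b.src ∈ maxDomT Θ.ν.M₁ (Z P i) 1}) →
          ‖((GaugeField.plaqHol U₀ p : SU2) : Matrix (Fin 2) (Fin 2) ℂ) - 1‖ ≤ δ P i),
      ∃ areg : ∀ P : B12.RunParams, ι P → ℝ, (∀ P i, 0 < areg P i) ∧
        ∀ P : B12.RunParams, lam.kSel P < P.K →
          B15Leaf (WOfRecord₁₃ F 2 (Θ.liveRepin₁₃ F 2)
            { lam with LF := fun P => lfVarOn su2Chart fun i => InstOn.std (Node00.bgMSCoPOfRecord F 2 Θ.ν P.K (k P i) (maxDomT Θ.ν.M₁ (Z P i))) Θ.ν.M₁ (Z P i) (Λ P i) (k P i) (M P i) (areg P i) (anExt (pts (k P i) (Λ P i)) (T P i) (fun177std (Node00.bgMSCoPOfRecord F 2 Θ.ν P.K (k P i) (maxDomT Θ.ν.M₁ (Z P i))) Θ.ν.M₁ (Z P i) (k P i)) (ext P i) (min (1 / 2) (min (R P i / 8) (γ₈ P / (M P i) ^ 5 * (R P i / 2) ^ 2 / (48 * (4 * ((Fintype.card (Plaq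 (F.P P.K) 0) : ℝ) * (1 + 8 * 𝓐₀ P i ^ 4)) / R P i + 1)))))) } P) := by
  choose δ₀ hδ₀ hmain using fun P : B12.RunParams =>
    exists_domain_prop1Printed_lfVarOn_std_su2_box_intrinsic_analytic_atZSeqCoPRecord_ofThm1TorusClass_ofMinimiserFamily_ofWindowGaugeLetter_ofChartHalf_ofCoercive (F := F) Θ.ν P.K (hd3 P) (h0 P)
      (Z := Z P) (Λ := Λ P) (k := k P) (M := M P) (hk0 := hk0 P) (hk := hk P) (eR := eR P) (heR := heR P) (T := T P) (lo := lo P) (hi := hi P) (n := n P) (hn := hn P)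
      (hN := hN P) (hbox := hbox P) (hZ := hZ P) (hTG0 := hTG0 P) (hN5 := hN5 P) (K := Kb P) (hK1 := hK1 P) (hKn := hKn P) (ext := ext P) (hext := hext P) (hlohi := hlohi P)
      (LO := LO P) (HI := HI P) (hLO := hLO P) (hHI := hHI P) (n' := n' P) (hn' := hn' P) (hn'N := hn'N P) (hR' := hR' P) (ρn := ρn P) (hρn := hρn P) (hγ := hγ P)
      (hcJ := hcJ P) (hbx := hbx P) (hbxM := hbxM P) (hM := hM P) (hR := hR P) (h𝓐₀ := h𝓐₀ P) (hMin := hMin P) (hΩw := hΩw P) (W := W P) (hWbox := hWbox P) (B := B P)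
      (M₂ := M₂ P) (hB0 := hB0 P) (hM₂0 := hM₂0 P) (hsb := hsb P) (hH := hH P) (hM₂ := hM₂ P) (hγle := hγle P) (hfar := fun i b hb => far_letter_of_box (hbox P i) (hZ1 P i) b hb)
      (hZblk := hZblk P) (hM2 := hM2) (hdiv := hdiv P) (hcE0 := hcE0 P) (hcE := hcE P) (hB₃ := hB₃) (heRa := heRa P) (ha₀ := ha₀) (hcA := hcA P) (h15T := thm1TorusClass_of_variationalThm1RegSepCoP7M Θ.ν P.K h15)
      (hcJ' := hcJ' P)
  refine ⟨δ₀, hδ₀, fun δtol hδtol hδtol_le hσW hPχ => ?_⟩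
  choose areg hapos hrow using fun P : B12.RunParams => hmain P (δtol P) (hδtol P) (hδtol_le P) (hσW P) (hPχ P)
  refine ⟨areg, hapos, fun P hkP => ?_⟩
  apply b15Leaf_WOfRecord₁₃_liveRepin₁₃_of_massLive_of_hasResiduals Θ _ hres (P := P)
  · exact hkP
  · exact hpin P hkP
  · exact hmassLive P hkP
  · exact hrow P
  · exact h180 P hkP
  · exact h189 P hkP

end Generic

end Summit.QuantumFields.YangMills.BalabanUVNodes.N12AtRecord13Prop1KnitThm1WindowDirectOfChartHalfOfRecord

end
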